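import Summits.BirchSwinnertonDyer.BirchSwinnertonDyer.Theorems.AlignedTransportAtTwoMainConjectureTransportAlignedAtTwoKilfordCopyCrossLevelFactorCurrency
import Summits.BirchSwinnertonDyer.BirchSwinnertonDyer.Theorems.AlignedTransportAtTwoMainConjectureTransportAlignedAtTwoKilfordCopyLevelRaisingParity
import HarnessLib

/-!
# Crux C1 `MainConjectureTransportAlignedAtTwo` (stmt-BirchSwinnertonDyer-22296), line `birth`, residual (R2) `stub_lamLawKilford`, UNEQUAL conductors —
# EVERY CONDUCTOR SHAPE: v27/v28's inline cross-level stub `stub_sameDepletedCopyKilfordNe` VERBATIM, FROM PLANE(2) AT THE COMMON LEVEL `lcm(N(W₁), N(W₂))`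
# for the two CANONICAL generalised old forms (width seat att-p3 g19; `--supports 22296`)

THEOREMS ONLY (no `def`, no `sorry`, no named fact). The last step of the general «factor-and-absorb» series (`…KilfordCopyCrossLevelFactor`,
`…FactorForms`, `…FactorCurrency`): the per-prime data of `…FactorCurrency.uniformize_depleted_iff_of_factorForms` are READ OFF the two conductors
`Nᵢ = N(Wᵢ)` and the parity of `a_ℓ` of the good curve at the other's additive primes, and ALL exactness / parity constraints are DISCHARGED in the tree
(`factorData_spec`: multiplicative `a_ℓ` odd, additive `a_ℓ = 0` — `…FactorCurrency` §2; good/multiplicative `a_ℓ` even — the Kraus–Oesterlé parity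
`…KilfordCopyLevelRaisingParity.even_LFunction_of_sharedCubicField_of_odd_LFunction`, att-p3 g18). The common level is `L = lcm(N₁, N₂)` (`factorLevel_dvd`).

THE CANONICAL DATA at an odd prime `ℓ ∣ N₁N₂` (`dᵢ :⟺ ℓ ∣ Nᵢ`, `sᵢ :⟺ ℓ² ∣ Nᵢ`; classes mod `2` of `1 − a_ℓV + 𝟙_{ℓ∤N}ℓV²`: good-even `(1+V)²`, good-odd `1+V+V²`,
multiplicative `1+V`, additive `1`):
* common factor `C_ℓ = [1] + β[ℓ]`, `β = 𝟙[¬s₁ ∧ ¬s₂]` (no additive prime ⟹ `C = 1+V`; else `C = 1`);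
* side factor `R⁽¹⁾_ℓ = [1] + ρ₁[ℓ] + σ₁[ℓ²]`, `σ₁ = 𝟙[¬d₁ ∧ s₂]`, `ρ₁ = 𝟙[(¬d₁ ∧ d₂ ∧ (¬s₂ ∨ a_ℓ(W₁) odd)) ∨ (d₁ ∧ ¬s₁ ∧ s₂)]`, i.e. `R⁽¹⁾ = 1+V` at
  (good₁, mult₂) and (mult₁, add₂), `1+V²` at (good₁ with `a_ℓ` even, add₂), `1+V+V²` at (good₁ with `a_ℓ` odd, add₂), `1` otherwise; symmetrically `R⁽²⁾`;
* the canonical generalised old forms `Fᵢ = Σ_m R⁽ⁱ⁾_m·m·ι_m fᵢ ∈ S₂(Γ₀(lcm(N₁,N₂)))` (`a_n(Fᵢ) = R⁽ⁱ⁾.coeff.sum (c, m ↦ c·m·𝟙_{m∣n}·a_{n/m}(fᵢ))`; mod `2`: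
  `Fᵢ ≡ fᵢ | ∏_ℓ R⁽ⁱ⁾_ℓ(V_ℓ)`). For two SEMISTABLE curves these are exactly att-p3 g18's old lines `F_{Q₂}`, `F_{Q₁}` at `L = N₀∏Q₁∏Q₂`.

* §1 `factorData_spec` — the six constraints at one prime. §2 `factorLevel_dvd` — `N₁·∏_{ℓ∈S}ℓ^{deg R⁽¹⁾_ℓ} ∣ lcm(N₁, N₂)`.
* §3 **`sameDepletedCopyKilfordNe_of_factorFormsPlane`** — `stub_sameDepletedCopyKilfordNe` (v27/v28, binder `N(W₁) ≠ N(W₂)`) VERBATIM from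
  `hPlane` := «for every pair as in the stub, with `L = lcm(N(W₁), N(W₂))` and the canonical forms `F₁, F₂` at level `L`:
  `u₁(c₁·y(F₁)/2) = O ↔ u₂(c₂·y(F₂)/2) = O` for every `y ∈ H₁(X₀(L);ℤ)`» — PLANE(2) at the common level, H12♯-shaped, the hypothesis of att-p4 g17's
  level- and form-agnostic kernel-letter consumer `…KilfordCopyCrossLevelCommonLevelLetter.uniformize_twoOldLines_ker_iff_of_alignedAtTwo`.

So after this file the cross-level input of (R2) is, for EVERY pair of conductors (not only semistable ones), ONE fixed-level statement at `lcm(N₁, N₂)`.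
BSD is not proved by this; C1 is not closed by this; `hPlane` is NOT discharged here (its kernel-letter discharge needs the level-`L` carrier rows: (W1)/(W3) on
`J₀(L)[2]`, a multiplicity-type input at `(L, 𝔪)`, (W0′) letters and non-vanishing for the two maps `θᵢ = Dᵢ.jacobiMapForm L Fᵢ`, and Hecke rows for the new
factor types `1+V²`, `1+V+V²` — -ty / att-p4 lineage). References: Greenberg–Vatsal 2000 §3 [GreenbergVatsal2000]; Kraus–Oesterlé 1992 Prop. 3 [KrausOesterle1992];
Cremona 1997 §2.4, §2.10 [CremonaAlgorithms1997]; Silverman ATAEC IV.10.2 [Silverman1994]; Kilford–Wiese 2008 Question 1.9 (reading) [KilfordWiese2008].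
-/

noncomputable section

-- justification: the `Summit.BirchSwinnertonDyer.BirchSwinnertonDyer.…` path repeats a component (route-file convention)
set_option linter.dupNamespace false
set_option autoImplicit false

open scoped MatrixGroups ModularForm Classical

open CongruenceSubgroup Complex WeierstrassCurve IsDedekindDomain Polynomial
open Literature.NumberTheory.EllipticCurves Literature.NumberTheory.EllipticCurves.ModularForms
open Literature.NumberTheory.EllipticCurves.Greenberg1999
open Summit.BirchSwinnertonDyer.Rank1Residual.F1Sign2
open Summit.BirchSwinnertonDyer.BirchSwinnertonDyer.Theorems.AlignedTransportAtTwoKilfordCopyCrossLevelFactorForms (exists_factorForm_coeff)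
open Summit.BirchSwinnertonDyer.BirchSwinnertonDyer.Theorems.AlignedTransportAtTwoKilfordCopyCrossLevelFactorCurrency
open Summit.BirchSwinnertonDyer.BirchSwinnertonDyer.Theorems.AlignedTransportAtTwoKilfordCopyLevelRaisingParity
  (even_LFunction_of_sharedCubicField_of_odd_LFunction ne_two_of_dvd_conductorNorm_of_isOrdinaryAt)

namespace Summit.BirchSwinnertonDyer.BirchSwinnertonDyer.Theorems.AlignedTransportAtTwoKilfordCopyCrossLevelFactorConductor

/-! ## §1 The canonical data at one odd prime of `N₁N₂`: the exactness and parity constraints hold -/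

/-- **The canonical factor data satisfy the six constraints of the general reduction** at an odd prime `ℓ ∣ N₁N₂` (data given by their characterisations,
`ε = 0`): `βσᵢ = 0`; `β + ρᵢ ≡ a_ℓ(Wᵢ)`; `βρᵢ + σᵢ ≡ 𝟙_{ℓ∤Nᵢ} (mod 2)`. Inputs: `ℓ ∥ N ⟹ a_ℓ` odd, `ℓ² ∣ N ⟹ a_ℓ = 0` (reduction types), and at a prime good
for one curve and multiplicative for the other the Kraus–Oesterlé parity `a_ℓ` even (shared cubic field). Eight-leaf case analysis on the two reduction types.
[cite: KrausOesterle1992, Prop. 3 (p. 262–263)] [cite: Silverman1994, IV.10.2] -/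
theorem factorData_spec (W₁ W₂ : WeierstrassCurve ℚ) [W₁.IsElliptic] [W₁.IsGloballyMinimal] [W₂.IsElliptic] [W₂.IsGloballyMinimal]
    {F : Type*} [Field F] [NumberField F] (hF : Module.finrank ℚ F = 3)
    (ht₁ : ∀ x : ℚ, ¬ HasRationalTwoTorsionX W₁ x) (ht₂ : ∀ x : ℚ, ¬ HasRationalTwoTorsionX W₂ x)
    {e₁ e₂ : F} (he₁ : aeval e₁ (twoDivisionUCubic W₁) = 0) (he₂ : aeval e₂ (twoDivisionUCubic W₂) = 0)
    {ℓ : ℕ} (hℓ : ℓ.Prime) (hℓ2 : ℓ ≠ 2) (hℓN : ℓ ∣ W₁.conductorNorm ℤ ∨ ℓ ∣ W₂.conductorNorm ℤ)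
    (β ρ₁ σ₁ ρ₂ σ₂ : ℤ)
    (hβ1 : (¬ ℓ ^ 2 ∣ W₁.conductorNorm ℤ ∧ ¬ ℓ ^ 2 ∣ W₂.conductorNorm ℤ) → β = 1) (hβ0 : ¬ (¬ ℓ ^ 2 ∣ W₁.conductorNorm ℤ ∧ ¬ ℓ ^ 2 ∣ W₂.conductorNorm ℤ) → β = 0)
    (hρ₁1 : ((¬ ℓ ∣ W₁.conductorNorm ℤ ∧ ℓ ∣ W₂.conductorNorm ℤ ∧ (¬ ℓ ^ 2 ∣ W₂.conductorNorm ℤ ∨ Odd (W₁.LFunction ℓ))) ∨ (ℓ ∣ W₁.conductorNorm ℤ ∧ ¬ ℓ ^ 2 ∣ W₁.conductorNorm ℤ ∧ ℓ ^ 2 ∣ W₂.conductorNorm ℤ)) → ρ₁ = 1) (hρ₁0 : ¬ ((¬ ℓ ∣ W₁.conductorNorm ℤ ∧ ℓ ∣ W₂.conductorNorm ℤ ∧ (¬ ℓ ^ 2 ∣ W₂.conductorNorm ℤ ∨ Odd (W₁.LFunction ℓ))) ∨ (ℓ ∣ W₁.conductorNorm ℤ ∧ ¬ ℓ ^ 2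 ∣ W₁.conductorNorm ℤ ∧ ℓ ^ 2 ∣ W₂.conductorNorm ℤ)) → ρ₁ = 0)
    (hσ₁1 : (¬ ℓ ∣ W₁.conductorNorm ℤ ∧ ℓ ^ 2 ∣ W₂.conductorNorm ℤ) → σ₁ = 1) (hσ₁0 : ¬ (¬ ℓ ∣ W₁.conductorNorm ℤ ∧ ℓ ^ 2 ∣ W₂.conductorNorm ℤ) → σ₁ = 0)
    (hρ₂1 : ((¬ ℓ ∣ W₂.conductorNorm ℤ ∧ ℓ ∣ W₁.conductorNorm ℤ ∧ (¬ ℓ ^ 2 ∣ W₁.conductorNorm ℤ ∨ Odd (W₂.LFunction ℓ))) ∨ (ℓ ∣ W₂.conductorNorm ℤ ∧ ¬ ℓ ^ 2 ∣ W₂.conductorNorm ℤ ∧ ℓ ^ 2 ∣ W₁.conductorNorm ℤ)) → ρ₂ = 1) (hρ₂0 : ¬ ((¬ ℓ ∣ W₂.conductorNorm ℤ ∧ ℓ ∣ W₁.conductorNorm ℤ ∧ (¬ ℓ ^ 2 ∣ W₁.conductorNorm ℤ ∨ Odd (W₂.LFunction ℓ))) ∨ (ℓ ∣ W₂.conductorNorm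 ℤ ∧ ¬ ℓ ^ 2 ∣ W₂.conductorNorm ℤ ∧ ℓ ^ 2 ∣ W₁.conductorNorm ℤ)) → ρ₂ = 0)
    (hσ₂1 : (¬ ℓ ∣ W₂.conductorNorm ℤ ∧ ℓ ^ 2 ∣ W₁.conductorNorm ℤ) → σ₂ = 1) (hσ₂0 : ¬ (¬ ℓ ∣ W₂.conductorNorm ℤ ∧ ℓ ^ 2 ∣ W₁.conductorNorm ℤ) → σ₂ = 0) :
    (β * σ₁ + 0 * ρ₁ = 0 ∧ (2 : ℤ) ∣ -W₁.LFunction ℓ - (β + ρ₁) ∧ (2 : ℤ) ∣ (if ℓ ∣ W₁.conductorNorm ℤ then 0 else 1) - (0 + β * ρ₁ + σ₁)) ∧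
    (β * σ₂ + 0 * ρ₂ = 0 ∧ (2 : ℤ) ∣ -W₂.LFunction ℓ - (β + ρ₂) ∧ (2 : ℤ) ∣ (if ℓ ∣ W₂.conductorNorm ℤ then 0 else 1) - (0 + β * ρ₂ + σ₂)) := by
  -- reduction-type dictionary
  have hsd₁ : ℓ ^ 2 ∣ W₁.conductorNorm ℤ → ℓ ∣ W₁.conductorNorm ℤ := fun h ↦ (dvd_pow_self ℓ two_ne_zero).trans h
  have hsd₂ : ℓ ^ 2 ∣ W₂.conductorNorm ℤ → ℓ ∣ W₂.conductorNorm ℤ := fun h ↦ (dvd_pow_self ℓ two_ne_zero).trans h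
  have hA₁ : ℓ ^ 2 ∣ W₁.conductorNorm ℤ → W₁.LFunction ℓ = 0 := fun h ↦ LFunction_eq_zero_of_sq_dvd_conductorNorm W₁ hℓ h
  have hA₂ : ℓ ^ 2 ∣ W₂.conductorNorm ℤ → W₂.LFunction ℓ = 0 := fun h ↦ LFunction_eq_zero_of_sq_dvd_conductorNorm W₂ hℓ h
  have hM₁ : ℓ ∣ W₁.conductorNorm ℤ → ¬ ℓ ^ 2 ∣ W₁.conductorNorm ℤ → ∃ k : ℤ, W₁.LFunction ℓ = 2 * k + 1 := fun h h' ↦ odd_LFunction_of_dvd_of_not_sq_dvd W₁ hℓ h h'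
  have hM₂ : ℓ ∣ W₂.conductorNorm ℤ → ¬ ℓ ^ 2 ∣ W₂.conductorNorm ℤ → ∃ k : ℤ, W₂.LFunction ℓ = 2 * k + 1 := fun h h' ↦ odd_LFunction_of_dvd_of_not_sq_dvd W₂ hℓ h h'
  -- Kraus–Oesterlé parities (both directions)
  have hKO₁ : ¬ ℓ ∣ W₁.conductorNorm ℤ → ℓ ∣ W₂.conductorNorm ℤ → ¬ ℓ ^ 2 ∣ W₂.conductorNorm ℤ → ∃ k : ℤ, W₁.LFunction ℓ = k + k := fun h₁ h₂ h₂' ↦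
    even_LFunction_of_sharedCubicField_of_odd_LFunction W₁ W₂ hF ht₂ he₁ he₂ hℓ hℓ2 h₁ h₂ (odd_LFunction_of_dvd_of_not_sq_dvd W₂ hℓ h₂ h₂')
  have hKO₂ : ¬ ℓ ∣ W₂.conductorNorm ℤ → ℓ ∣ W₁.conductorNorm ℤ → ¬ ℓ ^ 2 ∣ W₁.conductorNorm ℤ → ∃ k : ℤ, W₂.LFunction ℓ = k + k := fun h₂ h₁ h₁' ↦
    even_LFunction_of_sharedCubicField_of_odd_LFunction W₂ W₁ hF ht₁ he₂ he₁ hℓ hℓ2 h₂ h₁ (odd_LFunction_of_dvd_of_not_sq_dvd W₁ hℓ h₁ h₁')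
  by_cases s₁ : ℓ ^ 2 ∣ W₁.conductorNorm ℤ
  · have d₁ := hsd₁ s₁
    have a₁ := hA₁ s₁
    by_cases s₂ : ℓ ^ 2 ∣ W₂.conductorNorm ℤ
    · -- additive / additive
      have d₂ := hsd₂ s₂
      have a₂ := hA₂ s₂
      rw [hβ0 (fun h ↦ h.1 s₁), hρ₁0 (fun h ↦ h.elim (fun h ↦ h.1 d₁) (fun h ↦ h.2.1 s₁)), hσ₁0 (fun h ↦ h.1 d₁),
        hρ₂0 (fun h ↦ h.elim (fun h ↦ h.1 d₂) (fun h ↦ h.2.1 s₂)), hσ₂0 (fun h ↦ h.1 d₂), if_pos d₁, if_pos d₂, a₁, a₂]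
      norm_num
    · by_cases d₂ : ℓ ∣ W₂.conductorNorm ℤ
      · -- additive / multiplicative
        obtain ⟨k, hk⟩ := hM₂ d₂ s₂
        rw [hβ0 (fun h ↦ h.1 s₁), hρ₁0 (fun h ↦ h.elim (fun h ↦ h.1 d₁) (fun h ↦ h.2.1 s₁)), hσ₁0 (fun h ↦ h.1 d₁),
          hρ₂1 (Or.inr ⟨d₂, s₂, s₁⟩), hσ₂0 (fun h ↦ h.1 d₂), if_pos d₁, if_pos d₂, a₁, hk]
        refine ⟨⟨by norm_num, by norm_num, by norm_num⟩, by norm_num, ⟨-k - 1, by ring⟩, by norm_num⟩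
      · -- additive / good
        rw [hβ0 (fun h ↦ h.1 s₁), hρ₁0 (fun h ↦ h.elim (fun h ↦ h.1 d₁) (fun h ↦ h.2.1 s₁)), hσ₁0 (fun h ↦ h.1 d₁),
          hσ₂1 ⟨d₂, s₁⟩, if_pos d₁, if_neg d₂, a₁]
        by_cases o₂ : Odd (W₂.LFunction ℓ)
        · obtain ⟨k, hk⟩ := o₂
          rw [hρ₂1 (Or.inl ⟨d₂, d₁, Or.inr ⟨k, hk⟩⟩), hk]
          refine ⟨⟨by norm_num, by norm_num, by norm_num⟩, by norm_num, ⟨-k - 1, by ring⟩, by norm_num⟩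
        · obtain ⟨k, hk⟩ := Int.not_odd_iff_even.mp o₂
          rw [hρ₂0 (fun h ↦ h.elim (fun h ↦ h.2.2.elim (fun h ↦ h s₁) (fun h ↦ o₂ h)) (fun h ↦ d₂ h.1)), hk]
          refine ⟨⟨by norm_num, by norm_num, by norm_num⟩, by norm_num, ⟨-k, by ring⟩, by norm_num⟩
  · by_cases d₁ : ℓ ∣ W₁.conductorNorm ℤ
    · obtain ⟨k₁, hk₁⟩ := hM₁ d₁ s₁
      by_cases s₂ : ℓ ^ 2 ∣ W₂.conductorNorm ℤ
      · -- multiplicative / additive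
        have d₂ := hsd₂ s₂
        have a₂ := hA₂ s₂
        rw [hβ0 (fun h ↦ h.2 s₂), hρ₁1 (Or.inr ⟨d₁, s₁, s₂⟩), hσ₁0 (fun h ↦ h.1 d₁),
          hρ₂0 (fun h ↦ h.elim (fun h ↦ h.1 d₂) (fun h ↦ h.2.1 s₂)), hσ₂0 (fun h ↦ h.1 d₂), if_pos d₁, if_pos d₂, hk₁, a₂]
        refine ⟨⟨by norm_num, ⟨-k₁ - 1, by ring⟩, by norm_num⟩, by norm_num, by norm_num, by norm_num⟩
      · by_cases d₂ : ℓ ∣ W₂.conductorNorm ℤ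
        · -- multiplicative / multiplicative
          obtain ⟨k₂, hk₂⟩ := hM₂ d₂ s₂
          rw [hβ1 ⟨s₁, s₂⟩, hρ₁0 (fun h ↦ h.elim (fun h ↦ h.1 d₁) (fun h ↦ s₂ h.2.2)), hσ₁0 (fun h ↦ h.1 d₁),
            hρ₂0 (fun h ↦ h.elim (fun h ↦ h.1 d₂) (fun h ↦ s₁ h.2.2)), hσ₂0 (fun h ↦ h.1 d₂), if_pos d₁, if_pos d₂, hk₁, hk₂]
          refine ⟨⟨by norm_num, ⟨-k₁ - 1, by ring⟩, by norm_num⟩, by norm_num, ⟨-k₂ - 1, by ring⟩, by norm_num⟩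
        · -- multiplicative / good (Kraus–Oesterlé: `a_ℓ(W₂)` even)
          obtain ⟨k₂, hk₂⟩ := hKO₂ d₂ d₁ s₁
          rw [hβ1 ⟨s₁, s₂⟩, hρ₁0 (fun h ↦ h.elim (fun h ↦ h.1 d₁) (fun h ↦ s₂ h.2.2)), hσ₁0 (fun h ↦ h.1 d₁),
            hρ₂1 (Or.inl ⟨d₂, d₁, Or.inl s₁⟩), hσ₂0 (fun h ↦ s₁ h.2), if_pos d₁, if_neg d₂, hk₁, hk₂]
          refine ⟨⟨by norm_num, ⟨-k₁ - 1, by ring⟩, by norm_num⟩, by norm_num, ⟨-k₂ - 1, by ring⟩, by norm_num⟩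
    · -- `W₁` good at `ℓ`, so `ℓ ∣ N₂`
      have d₂ : ℓ ∣ W₂.conductorNorm ℤ := hℓN.resolve_left d₁
      by_cases s₂ : ℓ ^ 2 ∣ W₂.conductorNorm ℤ
      · -- good / additive: `R⁽¹⁾ = 1+V²` or `1+V+V²` according to the parity of `a_ℓ(W₁)`
        have a₂ := hA₂ s₂
        rw [hβ0 (fun h ↦ h.2 s₂), hσ₁1 ⟨d₁, s₂⟩, hρ₂0 (fun h ↦ h.elim (fun h ↦ h.1 d₂) (fun h ↦ h.2.1 s₂)), hσ₂0 (fun h ↦ h.1 d₂),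
          if_neg d₁, if_pos d₂, a₂]
        by_cases o₁ : Odd (W₁.LFunction ℓ)
        · obtain ⟨k, hk⟩ := o₁
          rw [hρ₁1 (Or.inl ⟨d₁, d₂, Or.inr ⟨k, hk⟩⟩), hk]
          refine ⟨⟨by norm_num, ⟨-k - 1, by ring⟩, by norm_num⟩, by norm_num, by norm_num, by norm_num⟩
        · obtain ⟨k, hk⟩ := Int.not_odd_iff_even.mp o₁
          rw [hρ₁0 (fun h ↦ h.elim (fun h ↦ h.2.2.elim (fun h ↦ h s₂) (fun h ↦ o₁ h)) (fun h ↦ d₁ h.1)), hk]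
          refine ⟨⟨by norm_num, ⟨-k, by ring⟩, by norm_num⟩, by norm_num, by norm_num, by norm_num⟩
      · -- good / multiplicative (Kraus–Oesterlé: `a_ℓ(W₁)` even): `C = R⁽¹⁾ = 1+V`
        obtain ⟨k₁, hk₁⟩ := hKO₁ d₁ d₂ s₂
        obtain ⟨k₂, hk₂⟩ := hM₂ d₂ s₂
        rw [hβ1 ⟨s₁, s₂⟩, hρ₁1 (Or.inl ⟨d₁, d₂, Or.inl s₂⟩), hσ₁0 (fun h ↦ s₂ h.2),
          hρ₂0 (fun h ↦ h.elim (fun h ↦ h.1 d₂) (fun h ↦ s₁ h.2.2)), hσ₂0 (fun h ↦ h.1 d₂), if_neg d₁, if_pos d₂, hk₁, hk₂]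
        refine ⟨⟨by norm_num, ⟨-k₁ - 1, by ring⟩, by norm_num⟩, by norm_num, ⟨-k₂ - 1, by ring⟩, by norm_num⟩

/-! ## §2 The common level is `lcm(N₁, N₂)` -/

/-- **`N₁·∏_{ℓ∈S} ℓ^{e₁(ℓ)} ∣ lcm(N₁, N₂)`** for the canonical exponents `e₁ = deg R⁽¹⁾_ℓ ∈ {0, 1, 2}` (`2` at (good₁, add₂), `1` at (good₁, bad₂) or
(mult₁, add₂), `0` otherwise; characterised by hypotheses): prime by prime, `v_ℓ(N₁) + e₁(ℓ) ≤ max(v_ℓ(N₁), v_ℓ(N₂))`. [cite: Silverman1994, IV.10.2] -/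
theorem factorLevel_dvd (N₁ N₂ : ℕ) (hN₁ : N₁ ≠ 0) (hN₂ : N₂ ≠ 0) (S : Finset ℕ) (hS : ∀ ℓ ∈ S, ℓ.Prime) (e : ℕ → ℕ)
    (he : ∀ ℓ ∈ S, e ℓ = 0 ∨ (e ℓ = 1 ∧ ((¬ ℓ ∣ N₁ ∧ ℓ ∣ N₂) ∨ (ℓ ∣ N₁ ∧ ¬ ℓ ^ 2 ∣ N₁ ∧ ℓ ^ 2 ∣ N₂))) ∨ (e ℓ = 2 ∧ ¬ ℓ ∣ N₁ ∧ ℓ ^ 2 ∣ N₂)) :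
    N₁ * ∏ ℓ ∈ S, ℓ ^ e ℓ ∣ Nat.lcm N₁ N₂ := by
  set K : ℕ := Nat.lcm N₁ N₂ / N₁ with hK
  have hlcm0 : Nat.lcm N₁ N₂ ≠ 0 := Nat.lcm_ne_zero hN₁ hN₂
  have hNK : N₁ * K = Nat.lcm N₁ N₂ := Nat.mul_div_cancel' (Nat.dvd_lcm_left N₁ N₂)
  have hK0 : K ≠ 0 := fun h ↦ hlcm0 (by rw [← hNK, h, mul_zero])
  rw [← hNK]
  refine mul_dvd_mul_left N₁ (prod_pow_dvd_of_forall_pow_dvd S hS e K fun ℓ hℓ ↦ ?_)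
  have hp := hS ℓ hℓ
  have hKf : K.factorization ℓ = max (N₁.factorization ℓ) (N₂.factorization ℓ) - N₁.factorization ℓ := by
    rw [hK, Nat.factorization_div (Nat.dvd_lcm_left N₁ N₂), Finsupp.tsub_apply, Nat.factorization_lcm hN₁ hN₂, Finsupp.sup_apply]
  rw [hp.pow_dvd_iff_le_factorization hK0, hKf]
  have v0 : ¬ ℓ ∣ N₁ → N₁.factorization ℓ = 0 := fun h ↦ Nat.factorization_eq_zero_of_not_dvd h
  have v1 : ℓ ∣ N₂ → 1 ≤ N₂.factorization ℓ := fun h ↦ (hp.dvd_iff_one_le_factorization hN₂).mp h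
  have v2 : ℓ ^ 2 ∣ N₂ → 2 ≤ N₂.factorization ℓ := fun h ↦ (hp.pow_dvd_iff_le_factorization hN₂).mp h
  have w1 : ℓ ∣ N₁ → 1 ≤ N₁.factorization ℓ := fun h ↦ (hp.dvd_iff_one_le_factorization hN₁).mp h
  have w2 : ¬ ℓ ^ 2 ∣ N₁ → N₁.factorization ℓ < 2 := fun h ↦ by
    by_contra h'; exact h ((hp.pow_dvd_iff_le_factorization hN₁).mpr (not_lt.mp h'))
  rcases he ℓ hℓ with h | ⟨h, hc⟩ | ⟨h, hd, hs⟩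
  · rw [h]; exact Nat.zero_le _
  · rw [h]
    rcases hc with ⟨hd, hd'⟩ | ⟨hd, hs, hs'⟩
    · have h0 := v0 hd; have h1 := v1 hd'
      rw [max_eq_right (by omega)]; omega
    · have h1 := w1 hd; have h2 := w2 hs; have h3 := v2 hs'
      rw [max_eq_right (by omega)]; omega
  · rw [h]
    have h0 := v0 hd; have h2 := v2 hs
    rw [max_eq_right (by omega)]; omega

/-! ## §3 v27/v28's inline cross-level stub VERBATIM, from PLANE(2) at `lcm(N₁, N₂)` for the canonical generalised old forms -/

/-- **`stub_sameDepletedCopyKilfordNe` (line `birth` v27/v28 — the ONE inline open statement of (R2) at UNEQUAL conductors) FROM PLANE(2) AT THE COMMON LEVEL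
ALONE, EVERY CONDUCTOR SHAPE.** `hPlane`: for every pair as in the stub and the two canonical generalised old forms `F₁, F₂ ∈ S₂(Γ₀(L))`, `L = lcm(N(W₁), N(W₂))`
(given by their `q`-expansions through the canonical data of this file's header), the half-class kernels at level `L` agree. CONCLUSION: the stub verbatim
(`S = primeFactors(N₁N₂) ∖ {2}`, `N' = N₁N₂∏ℓ²`, the `S`-depleted newforms `g₁, g₂`). Proof: `S` consists of odd primes dividing `N₁N₂` (`2 ∤ Nᵢ`: good at `2`),
`factorData_spec` at each (Kraus–Oesterlé inside), `factorLevel_dvd` on both sides, the canonical forms exist (`…FactorForms.exists_factorForm_coeff`), and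
`…FactorCurrency.uniformize_depleted_iff_of_factorForms`. Supersedes the semistable-only `…CrossLevelSemistablePairs` (whose old lines are the case
`R ∈ {1, 1+V}`). [cite: GreenbergVatsal2000, §3] [cite: KrausOesterle1992, Prop. 3 (p. 262–263)] [cite: CremonaAlgorithms1997, §2.4 and §2.10]
[cite: KilfordWiese2008, Question 1.9] -/
theorem sameDepletedCopyKilfordNe_of_factorFormsPlane
    (hPlane : ∀ (W₁ : WeierstrassCurve ℚ) [W₁.IsElliptic] [W₁.IsGloballyMinimal]
      (W₂ : WeierstrassCurve ℚ) [W₂.IsElliptic] [W₂.IsGloballyMinimal],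
      IsOrdinaryAt W₁ 2 → IsOrdinaryAt W₂ 2 →
      (∀ x : ℚ, ¬ HasRationalTwoTorsionX W₁ x) → (∀ x : ℚ, ¬ HasRationalTwoTorsionX W₂ x) →
      ¬ IsSquare W₁.Δ → ¬ IsSquare W₂.Δ →
      (¬ ∃ (d : ℚ) (c : WeierstrassCurve.VariableChange ℚ), c • W₁.quadraticTwist d = W₂) →
      OnKilfordStratumAtTwo W₁ → W₁.conductorNorm ℤ ≠ W₂.conductorNorm ℤ →
      ∀ (F : Type) [Field F] [NumberField F], Module.finrank ℚ F = 3 →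
      ∀ e₁ e₂ : F, aeval e₁ (twoDivisionUCubic W₁) = 0 → aeval e₂ (twoDivisionUCubic W₂) = 0 →
      AlignedAtTwo F e₁ e₂ → AlignedAtInfinity F (twoDivisionUCubic W₁) (twoDivisionUCubic W₂) e₁ e₂ →
      ∀ [NeZero (W₁.conductorNorm ℤ)] [NeZero (W₂.conductorNorm ℤ)]
        (D₁ : ModularParametrizationData W₁ (W₁.conductorNorm ℤ)) (D₂ : ModularParametrizationData W₂ (W₂.conductorNorm ℤ)),
        Odd D₁.c → Odd D₂.c →
      ∀ (L : ℕ) [NeZero L], L = Nat.lcm (W₁.conductorNorm ℤ) (W₂.conductorNorm ℤ) →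
      ∀ (F₁ F₂ : CuspForm (Gamma0 L) 2),
        (∀ n : ℕ, cuspCoeff F₁ n =
          ((∏ ℓ ∈ (W₁.conductorNorm ℤ * W₂.conductorNorm ℤ).primeFactors.erase 2,
            (MonoidAlgebra.single 1 (1 : ℂ) + MonoidAlgebra.single ℓ ((if ((¬ ℓ ∣ W₁.conductorNorm ℤ ∧ ℓ ∣ W₂.conductorNorm ℤ ∧ (¬ ℓ ^ 2 ∣ W₂.conductorNorm ℤ ∨ Odd (W₁.LFunction ℓ))) ∨ (ℓ ∣ W₁.conductorNorm ℤ ∧ ¬ ℓ ^ 2 ∣ W₁.conductorNorm ℤ ∧ ℓ ^ 2 ∣ W₂.conductorNorm ℤ)) then (1 : ℤ) else 0 : ℤ) : ℂ) +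
              MonoidAlgebra.single (ℓ ^ 2) ((if (¬ ℓ ∣ W₁.conductorNorm ℤ ∧ ℓ ^ 2 ∣ W₂.conductorNorm ℤ) then (1 : ℤ) else 0 : ℤ) : ℂ)) : MonoidAlgebra ℂ ℕ).coeff.sum
            fun m c ↦ c * ((m : ℂ) * if m ∣ n then cuspCoeff D₁.f (n / m) else 0))) →
        (∀ n : ℕ, cuspCoeff F₂ n =
          ((∏ ℓ ∈ (W₁.conductorNorm ℤ * W₂.conductorNorm ℤ).primeFactors.erase 2,
            (MonoidAlgebra.single 1 (1 : ℂ) + MonoidAlgebra.single ℓ ((if ((¬ ℓ ∣ W₂.conductorNorm ℤ ∧ ℓ ∣ W₁.conductorNorm ℤ ∧ (¬ ℓ ^ 2 ∣ W₁.conductorNorm ℤ ∨ Odd (W₂.LFunction ℓ))) ∨ (ℓ ∣ W₂.conductorNorm ℤ ∧ ¬ ℓ ^ 2 ∣ W₂.conductorNorm ℤ ∧ ℓ ^ 2 ∣ W₁.conductorNorm ℤ)) then (1 : ℤ) else 0 : ℤ) : ℂ) +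
              MonoidAlgebra.single (ℓ ^ 2) ((if (¬ ℓ ∣ W₂.conductorNorm ℤ ∧ ℓ ^ 2 ∣ W₁.conductorNorm ℤ) then (1 : ℤ) else 0 : ℤ) : ℂ)) : MonoidAlgebra ℂ ℕ).coeff.sum
            fun m c ↦ c * ((m : ℂ) * if m ∣ n then cuspCoeff D₂.f (n / m) else 0))) →
      ∀ y ∈ periodHomology L,
        D₁.uniformize ((D₁.c : ℂ) * y F₁ / 2) = 0 ↔ D₂.uniformize ((D₂.c : ℂ) * y F₂ / 2) = 0) :
    ∀ (W₁ : WeierstrassCurve ℚ) [W₁.IsElliptic] [W₁.IsGloballyMinimal]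
      (W₂ : WeierstrassCurve ℚ) [W₂.IsElliptic] [W₂.IsGloballyMinimal],
      IsOrdinaryAt W₁ 2 → IsOrdinaryAt W₂ 2 →
      (∀ x : ℚ, ¬ HasRationalTwoTorsionX W₁ x) → (∀ x : ℚ, ¬ HasRationalTwoTorsionX W₂ x) →
      ¬ IsSquare W₁.Δ → ¬ IsSquare W₂.Δ →
      (¬ ∃ (d : ℚ) (c : WeierstrassCurve.VariableChange ℚ), c • W₁.quadraticTwist d = W₂) →
      OnKilfordStratumAtTwo W₁ → W₁.conductorNorm ℤ ≠ W₂.conductorNorm ℤ →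
      ∀ (F : Type) [Field F] [NumberField F], Module.finrank ℚ F = 3 →
      ∀ e₁ e₂ : F, aeval e₁ (twoDivisionUCubic W₁) = 0 → aeval e₂ (twoDivisionUCubic W₂) = 0 →
      AlignedAtTwo F e₁ e₂ → AlignedAtInfinity F (twoDivisionUCubic W₁) (twoDivisionUCubic W₂) e₁ e₂ →
      ∀ [NeZero (W₁.conductorNorm ℤ)] [NeZero (W₂.conductorNorm ℤ)]
        (D₁ : ModularParametrizationData W₁ (W₁.conductorNorm ℤ)) (D₂ : ModularParametrizationData W₂ (W₂.conductorNorm ℤ)),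
        Odd D₁.c → Odd D₂.c →
      ∀ (N' : ℕ) [NeZero N'], N' = W₁.conductorNorm ℤ * W₂.conductorNorm ℤ *
          ∏ ℓ ∈ (W₁.conductorNorm ℤ * W₂.conductorNorm ℤ).primeFactors.erase 2, ℓ ^ 2 →
      ∀ (g₁ g₂ : CuspForm (Gamma0 N') 2),
        (∀ n : ℕ, cuspCoeff g₁ n =
          if ∃ ℓ ∈ (W₁.conductorNorm ℤ * W₂.conductorNorm ℤ).primeFactors.erase 2, ℓ ∣ n then 0 else cuspCoeff D₁.f n) →
        (∀ n : ℕ, cuspCoeff g₂ n =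
          if ∃ ℓ ∈ (W₁.conductorNorm ℤ * W₂.conductorNorm ℤ).primeFactors.erase 2, ℓ ∣ n then 0 else cuspCoeff D₂.f n) →
      ∀ x ∈ periodHomology N',
        D₁.uniformize ((D₁.c : ℂ) *
            ((((∏ ℓ ∈ (W₁.conductorNorm ℤ * W₂.conductorNorm ℤ).primeFactors.erase 2, ℓ ^ 2 : ℕ) : ℂ) * x g₁) / 2)) = 0 ↔
          D₂.uniformize ((D₂.c : ℂ) *
            ((((∏ ℓ ∈ (W₁.conductorNorm ℤ * W₂.conductorNorm ℤ).primeFactors.erase 2, ℓ ^ 2 : ℕ) : ℂ) * x g₂) / 2)) = 0 := by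
  intro W₁ _ _ W₂ _ _ hord₁ hord₂ ht₁ ht₂ hsq₁ hsq₂ htw hK hne F _ _ hF e₁ e₂ he₁ he₂ h2 hal _ _ D₁ D₂ hc₁ hc₂ N' _ hN' g₁ g₂ hg₁ hg₂ x hx
  classical
  set S : Finset ℕ := (W₁.conductorNorm ℤ * W₂.conductorNorm ℤ).primeFactors.erase 2 with hSdef
  have hN₁ : W₁.conductorNorm ℤ ≠ 0 := NeZero.ne _
  have hN₂ : W₂.conductorNorm ℤ ≠ 0 := NeZero.ne _
  have hS : ∀ ℓ ∈ S, ℓ.Prime := fun ℓ hℓ ↦ Nat.prime_of_mem_primeFactors (Finset.mem_of_mem_erase hℓ)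
  have hS0 : ∀ ℓ ∈ S, ℓ ≠ 0 := fun ℓ hℓ ↦ (hS ℓ hℓ).ne_zero
  have hS2 : ∀ ℓ ∈ S, ℓ ≠ 2 := fun ℓ hℓ ↦ Finset.ne_of_mem_erase hℓ
  have hSodd : ∀ ℓ ∈ S, Odd ℓ := fun ℓ hℓ ↦ (hS ℓ hℓ).odd_of_ne_two (hS2 ℓ hℓ)
  have hSN : ∀ ℓ ∈ S, ℓ ∣ W₁.conductorNorm ℤ ∨ ℓ ∣ W₂.conductorNorm ℤ := fun ℓ hℓ ↦
    (Nat.Prime.dvd_mul (hS ℓ hℓ)).mp (Nat.dvd_of_mem_primeFactors (Finset.mem_of_mem_erase hℓ))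
  -- the constraints, prime by prime
  have spec := fun (ℓ : ℕ) (hℓ : ℓ ∈ S) ↦ factorData_spec W₁ W₂ hF ht₁ ht₂ he₁ he₂ (hS ℓ hℓ) (hS2 ℓ hℓ) (hSN ℓ hℓ)
    ((fun ℓ ↦ if (¬ ℓ ^ 2 ∣ W₁.conductorNorm ℤ ∧ ¬ ℓ ^ 2 ∣ W₂.conductorNorm ℤ) then (1 : ℤ) else 0) ℓ) ((fun ℓ ↦ if ((¬ ℓ ∣ W₁.conductorNorm ℤ ∧ ℓ ∣ W₂.conductorNorm ℤ ∧ (¬ ℓ ^ 2 ∣ W₂.conductorNorm ℤ ∨ Odd (W₁.LFunction ℓ))) ∨ (ℓ ∣ W₁.conductorNorm ℤ ∧ ¬ ℓ ^ 2 ∣ W₁.conductorNorm ℤ ∧ ℓ ^ 2 ∣ W₂.conductorNorm ℤ)) then (1 : ℤ) else 0) ℓ) ((fun ℓ ↦ if (¬ ℓ ∣ W₁.conductorNorm ℤ ∧ ℓ ^ 2 ∣ W₂.conductorNorm ℤ) then (1 : ℤ) else 0) ℓ) ((fun ℓ ↦ if ((¬ ℓ ∣ W₂.conductorNorm ℤ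 ∧ ℓ ∣ W₁.conductorNorm ℤ ∧ (¬ ℓ ^ 2 ∣ W₁.conductorNorm ℤ ∨ Odd (W₂.LFunction ℓ))) ∨ (ℓ ∣ W₂.conductorNorm ℤ ∧ ¬ ℓ ^ 2 ∣ W₂.conductorNorm ℤ ∧ ℓ ^ 2 ∣ W₁.conductorNorm ℤ)) then (1 : ℤ) else 0) ℓ) ((fun ℓ ↦ if (¬ ℓ ∣ W₂.conductorNorm ℤ ∧ ℓ ^ 2 ∣ W₁.conductorNorm ℤ) then (1 : ℤ) else 0) ℓ)
    (fun h ↦ if_pos h) (fun h ↦ if_neg h) (fun h ↦ if_pos h) (fun h ↦ if_neg h) (fun h ↦ if_pos h) (fun h ↦ if_neg h)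
    (fun h ↦ if_pos h) (fun h ↦ if_neg h) (fun h ↦ if_pos h) (fun h ↦ if_neg h)
  -- the exponents and the common level `L = lcm`
  set L : ℕ := Nat.lcm (W₁.conductorNorm ℤ) (W₂.conductorNorm ℤ) with hLdef
  haveI : NeZero L := ⟨Nat.lcm_ne_zero hN₁ hN₂⟩
  have hρe₁ : ∀ ℓ ∈ S, (fun ℓ ↦ if (¬ ℓ ∣ W₁.conductorNorm ℤ ∧ ℓ ^ 2 ∣ W₂.conductorNorm ℤ) then 2 else if ((¬ ℓ ∣ W₁.conductorNorm ℤ ∧ ℓ ∣ W₂.conductorNorm ℤ ∧ (¬ ℓ ^ 2 ∣ W₂.conductorNorm ℤ ∨ Odd (W₁.LFunction ℓ))) ∨ (ℓ ∣ W₁.conductorNorm ℤ ∧ ¬ ℓ ^ 2 ∣ W₁.conductorNorm ℤ ∧ ℓ ^ 2 ∣ W₂.conductorNorm ℤ)) then 1 else 0) ℓ = 0 → (fun ℓ ↦ if ((¬ ℓ ∣ W₁.conductorNorm ℤ ∧ ℓ ∣ W₂.conductorNorm ℤ ∧ (¬ ℓ ^ 2 ∣ W₂.conductorNorm ℤ ∨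 Odd (W₁.LFunction ℓ))) ∨ (ℓ ∣ W₁.conductorNorm ℤ ∧ ¬ ℓ ^ 2 ∣ W₁.conductorNorm ℤ ∧ ℓ ^ 2 ∣ W₂.conductorNorm ℤ)) then (1 : ℤ) else 0) ℓ = 0 := by
    intro ℓ _ h
    dsimp only at h ⊢
    split_ifs at h with h1 h2
    all_goals omega
  have hσe₁ : ∀ ℓ ∈ S, (fun ℓ ↦ if (¬ ℓ ∣ W₁.conductorNorm ℤ ∧ ℓ ^ 2 ∣ W₂.conductorNorm ℤ) then 2 else if ((¬ ℓ ∣ W₁.conductorNorm ℤ ∧ ℓ ∣ W₂.conductorNorm ℤ ∧ (¬ ℓ ^ 2 ∣ W₂.conductorNorm ℤ ∨ Odd (W₁.LFunction ℓ))) ∨ (ℓ ∣ W₁.conductorNorm ℤ ∧ ¬ ℓ ^ 2 ∣ W₁.conductorNorm ℤ ∧ ℓ ^ 2 ∣ W₂.conductorNorm ℤ)) then 1 else 0) ℓ ≤ 1 → (fun ℓ ↦ if (¬ ℓ ∣ W₁.conductorNorm ℤ ∧ ℓ ^ 2 ∣ W₂.conductorNorm ℤ) then (1 : ℤ) else 0)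 ℓ = 0 := by
    intro ℓ _ h
    dsimp only at h ⊢
    split_ifs at h with h1 h2
    all_goals omega
  have hρe₂ : ∀ ℓ ∈ S, (fun ℓ ↦ if (¬ ℓ ∣ W₂.conductorNorm ℤ ∧ ℓ ^ 2 ∣ W₁.conductorNorm ℤ) then 2 else if ((¬ ℓ ∣ W₂.conductorNorm ℤ ∧ ℓ ∣ W₁.conductorNorm ℤ ∧ (¬ ℓ ^ 2 ∣ W₁.conductorNorm ℤ ∨ Odd (W₂.LFunction ℓ))) ∨ (ℓ ∣ W₂.conductorNorm ℤ ∧ ¬ ℓ ^ 2 ∣ W₂.conductorNorm ℤ ∧ ℓ ^ 2 ∣ W₁.conductorNorm ℤ)) then 1 else 0) ℓ = 0 → (fun ℓ ↦ if ((¬ ℓ ∣ W₂.conductorNorm ℤ ∧ ℓ ∣ W₁.conductorNorm ℤ ∧ (¬ ℓ ^ 2 ∣ W₁.conductorNorm ℤ ∨ Odd (W₂.LFunction ℓ))) ∨ (ℓ ∣ W₂.conductorNorm ℤ ∧ ¬ ℓ ^ 2 ∣ W₂.conductorNorm ℤ ∧ ℓ ^ 2 ∣ W₁.conductorNorm ℤ))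 then (1 : ℤ) else 0) ℓ = 0 := by
    intro ℓ _ h
    dsimp only at h ⊢
    split_ifs at h with h1 h2
    all_goals omega
  have hσe₂ : ∀ ℓ ∈ S, (fun ℓ ↦ if (¬ ℓ ∣ W₂.conductorNorm ℤ ∧ ℓ ^ 2 ∣ W₁.conductorNorm ℤ) then 2 else if ((¬ ℓ ∣ W₂.conductorNorm ℤ ∧ ℓ ∣ W₁.conductorNorm ℤ ∧ (¬ ℓ ^ 2 ∣ W₁.conductorNorm ℤ ∨ Odd (W₂.LFunction ℓ))) ∨ (ℓ ∣ W₂.conductorNorm ℤ ∧ ¬ ℓ ^ 2 ∣ W₂.conductorNorm ℤ ∧ ℓ ^ 2 ∣ W₁.conductorNorm ℤ)) then 1 else 0) ℓ ≤ 1 → (fun ℓ ↦ if (¬ ℓ ∣ W₂.conductorNorm ℤ ∧ ℓ ^ 2 ∣ W₁.conductorNorm ℤ) then (1 : ℤ) else 0) ℓ = 0 := by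
    intro ℓ _ h
    dsimp only at h ⊢
    split_ifs at h with h1 h2
    all_goals omega
  have hL₁ : W₁.conductorNorm ℤ * ∏ ℓ ∈ S, ℓ ^ (fun ℓ ↦ if (¬ ℓ ∣ W₁.conductorNorm ℤ ∧ ℓ ^ 2 ∣ W₂.conductorNorm ℤ) then 2 else if ((¬ ℓ ∣ W₁.conductorNorm ℤ ∧ ℓ ∣ W₂.conductorNorm ℤ ∧ (¬ ℓ ^ 2 ∣ W₂.conductorNorm ℤ ∨ Odd (W₁.LFunction ℓ))) ∨ (ℓ ∣ W₁.conductorNorm ℤ ∧ ¬ ℓ ^ 2 ∣ W₁.conductorNorm ℤ ∧ ℓ ^ 2 ∣ W₂.conductorNorm ℤ)) then 1 else 0) ℓ ∣ L := by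
    refine factorLevel_dvd _ _ hN₁ hN₂ S hS _ fun ℓ hℓ ↦ ?_
    split_ifs with h1 h2
    · exact Or.inr (Or.inr ⟨rfl, h1.1, h1.2⟩)
    · refine Or.inr (Or.inl ⟨rfl, ?_⟩)
      rcases h2 with h2 | h2
      · exact Or.inl ⟨h2.1, h2.2.1⟩
      · exact Or.inr h2
    · exact Or.inl rfl
  have hL₂ : W₂.conductorNorm ℤ * ∏ ℓ ∈ S, ℓ ^ (fun ℓ ↦ if (¬ ℓ ∣ W₂.conductorNorm ℤ ∧ ℓ ^ 2 ∣ W₁.conductorNorm ℤ) then 2 else if ((¬ ℓ ∣ W₂.conductorNorm ℤ ∧ ℓ ∣ W₁.conductorNorm ℤ ∧ (¬ ℓ ^ 2 ∣ W₁.conductorNorm ℤ ∨ Odd (W₂.LFunction ℓ))) ∨ (ℓ ∣ W₂.conductorNorm ℤ ∧ ¬ ℓ ^ 2 ∣ W₂.conductorNorm ℤ ∧ ℓ ^ 2 ∣ W₁.conductorNorm ℤ)) then 1 else 0) ℓ ∣ L := by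
    rw [hLdef, Nat.lcm_comm]
    refine factorLevel_dvd _ _ hN₂ hN₁ S hS _ fun ℓ hℓ ↦ ?_
    split_ifs with h1 h2
    · exact Or.inr (Or.inr ⟨rfl, h1.1, h1.2⟩)
    · refine Or.inr (Or.inl ⟨rfl, ?_⟩)
      rcases h2 with h2 | h2
      · exact Or.inl ⟨h2.1, h2.2.1⟩
      · exact Or.inr h2
    · exact Or.inl rfl
  -- the canonical forms and PLANE(2) at level `L`
  obtain ⟨F₁, hF₁c, -, -⟩ := exists_factorForm_coeff D₁.f _ D₁.isNewformOf.2 (fun ℓ ↦ if ((¬ ℓ ∣ W₁.conductorNorm ℤ ∧ ℓ ∣ W₂.conductorNorm ℤ ∧ (¬ ℓ ^ 2 ∣ W₂.conductorNorm ℤ ∨ Odd (W₁.LFunction ℓ))) ∨ (ℓ ∣ W₁.conductorNorm ℤ ∧ ¬ ℓ ^ 2 ∣ W₁.conductorNorm ℤ ∧ ℓ ^ 2 ∣ W₂.conductorNorm ℤ)) then (1 : ℤ) else 0) (fun ℓ ↦ if (¬ ℓ ∣ W₁.conductorNorm ℤ ∧ ℓ ^ 2 ∣ W₂.conductorNorm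 ℤ) then (1 : ℤ) else 0) (fun ℓ ↦ if (¬ ℓ ∣ W₁.conductorNorm ℤ ∧ ℓ ^ 2 ∣ W₂.conductorNorm ℤ) then 2 else if ((¬ ℓ ∣ W₁.conductorNorm ℤ ∧ ℓ ∣ W₂.conductorNorm ℤ ∧ (¬ ℓ ^ 2 ∣ W₂.conductorNorm ℤ ∨ Odd (W₁.LFunction ℓ))) ∨ (ℓ ∣ W₁.conductorNorm ℤ ∧ ¬ ℓ ^ 2 ∣ W₁.conductorNorm ℤ ∧ ℓ ^ 2 ∣ W₂.conductorNorm ℤ)) then 1 else 0) S hS0 hρe₁ hσe₁ L hL₁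
  obtain ⟨F₂, hF₂c, -, -⟩ := exists_factorForm_coeff D₂.f _ D₂.isNewformOf.2 (fun ℓ ↦ if ((¬ ℓ ∣ W₂.conductorNorm ℤ ∧ ℓ ∣ W₁.conductorNorm ℤ ∧ (¬ ℓ ^ 2 ∣ W₁.conductorNorm ℤ ∨ Odd (W₂.LFunction ℓ))) ∨ (ℓ ∣ W₂.conductorNorm ℤ ∧ ¬ ℓ ^ 2 ∣ W₂.conductorNorm ℤ ∧ ℓ ^ 2 ∣ W₁.conductorNorm ℤ)) then (1 : ℤ) else 0) (fun ℓ ↦ if (¬ ℓ ∣ W₂.conductorNorm ℤ ∧ ℓ ^ 2 ∣ W₁.conductorNorm ℤ) then (1 : ℤ) else 0) (fun ℓ ↦ if (¬ ℓ ∣ W₂.conductorNorm ℤ ∧ ℓ ^ 2 ∣ W₁.conductorNorm ℤ) then 2 else if ((¬ ℓ ∣ W₂.conductorNorm ℤ ∧ ℓ ∣ W₁.conductorNorm ℤ ∧ (¬ ℓ ^ 2 ∣ W₁.conductorNorm ℤ ∨ Odd (W₂.LFunction ℓ))) ∨ (ℓ ∣ W₂.conductorNorm ℤ ∧ ¬ ℓ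 ^ 2 ∣ W₂.conductorNorm ℤ ∧ ℓ ^ 2 ∣ W₁.conductorNorm ℤ)) then 1 else 0) S hS0 hρe₂ hσe₂ L hL₂
  have hker := hPlane W₁ W₂ hord₁ hord₂ ht₁ ht₂ hsq₁ hsq₂ htw hK hne F hF e₁ e₂ he₁ he₂ h2 hal D₁ D₂ hc₁ hc₂ L rfl F₁ F₂ hF₁c hF₂c
  -- the depleted level
  have hLN : L ∣ W₁.conductorNorm ℤ * W₂.conductorNorm ℤ := Nat.lcm_dvd_mul _ _
  have hL' : L * ∏ ℓ ∈ S, ℓ ^ 2 ∣ N' := by rw [hN']; exact mul_dvd_mul_right hLN _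
  have hN₁' : W₁.conductorNorm ℤ * ∏ ℓ ∈ S, ℓ ^ 2 ∣ N' := by rw [hN']; exact mul_dvd_mul_right (Dvd.intro _ rfl) _
  have hN₂' : W₂.conductorNorm ℤ * ∏ ℓ ∈ S, ℓ ^ 2 ∣ N' := by rw [hN']; exact mul_dvd_mul_right (Dvd.intro_left _ rfl) _
  exact uniformize_depleted_iff_of_factorForms D₁ D₂ S hS hSodd (fun ℓ ↦ if (¬ ℓ ^ 2 ∣ W₁.conductorNorm ℤ ∧ ¬ ℓ ^ 2 ∣ W₂.conductorNorm ℤ) then (1 : ℤ) else 0) (fun _ ↦ (0 : ℤ)) (fun ℓ ↦ if ((¬ ℓ ∣ W₁.conductorNorm ℤ ∧ ℓ ∣ W₂.conductorNorm ℤ ∧ (¬ ℓ ^ 2 ∣ W₂.conductorNorm ℤ ∨ Odd (W₁.LFunction ℓ))) ∨ (ℓ ∣ W₁.conductorNorm ℤ ∧ ¬ ℓ ^ 2 ∣ W₁.conductorNorm ℤ ∧ ℓ ^ 2 ∣ W₂.conductorNorm ℤ)) then (1 : ℤ) else 0) (fun ℓ ↦ if (¬ ℓ ∣ W₁.conductorNorm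 ℤ ∧ ℓ ^ 2 ∣ W₂.conductorNorm ℤ) then (1 : ℤ) else 0) (fun ℓ ↦ if ((¬ ℓ ∣ W₂.conductorNorm ℤ ∧ ℓ ∣ W₁.conductorNorm ℤ ∧ (¬ ℓ ^ 2 ∣ W₁.conductorNorm ℤ ∨ Odd (W₂.LFunction ℓ))) ∨ (ℓ ∣ W₂.conductorNorm ℤ ∧ ¬ ℓ ^ 2 ∣ W₂.conductorNorm ℤ ∧ ℓ ^ 2 ∣ W₁.conductorNorm ℤ)) then (1 : ℤ) else 0) (fun ℓ ↦ if (¬ ℓ ∣ W₂.conductorNorm ℤ ∧ ℓ ^ 2 ∣ W₁.conductorNorm ℤ) then (1 : ℤ) else 0) (fun ℓ ↦ if (¬ ℓ ∣ W₁.conductorNorm ℤ ∧ ℓ ^ 2 ∣ W₂.conductorNorm ℤ) then 2 else if ((¬ ℓ ∣ W₁.conductorNorm ℤ ∧ ℓ ∣ W₂.conductorNorm ℤ ∧ (¬ ℓ ^ 2 ∣ W₂.conductorNorm ℤ ∨ Odd (W₁.LFunction ℓ))) ∨ (ℓ ∣ W₁.conductorNorm ℤ ∧ ¬ ℓ ^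 2 ∣ W₁.conductorNorm ℤ ∧ ℓ ^ 2 ∣ W₂.conductorNorm ℤ)) then 1 else 0) (fun ℓ ↦ if (¬ ℓ ∣ W₂.conductorNorm ℤ ∧ ℓ ^ 2 ∣ W₁.conductorNorm ℤ) then 2 else if ((¬ ℓ ∣ W₂.conductorNorm ℤ ∧ ℓ ∣ W₁.conductorNorm ℤ ∧ (¬ ℓ ^ 2 ∣ W₁.conductorNorm ℤ ∨ Odd (W₂.LFunction ℓ))) ∨ (ℓ ∣ W₂.conductorNorm ℤ ∧ ¬ ℓ ^ 2 ∣ W₂.conductorNorm ℤ ∧ ℓ ^ 2 ∣ W₁.conductorNorm ℤ)) then 1 else 0)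
    (fun ℓ hℓ ↦ (spec ℓ hℓ).1.1) (fun ℓ _ ↦ zero_mul _) (fun ℓ hℓ ↦ (spec ℓ hℓ).2.1) (fun ℓ _ ↦ zero_mul _)
    (fun ℓ hℓ ↦ (spec ℓ hℓ).1.2.1) (fun ℓ hℓ ↦ (spec ℓ hℓ).1.2.2) (fun ℓ hℓ ↦ (spec ℓ hℓ).2.2.1) (fun ℓ hℓ ↦ (spec ℓ hℓ).2.2.2)
    hρe₁ hσe₁ hL₁ hρe₂ hσe₂ hL₂ N' hN₁' hN₂' hL' g₁ g₂ hg₁ hg₂ F₁ F₂ hF₁c hF₂c hker x hx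

end Summit.BirchSwinnertonDyer.BirchSwinnertonDyer.Theorems.AlignedTransportAtTwoKilfordCopyCrossLevelFactorConductor

end
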